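import Summits.CriticalPhenomena.CardyFormulaZ2.Theorems.CardyIKTransportCornerLineDescentSummitStrength

/-!
# Strategy census r1 (redirect strategist, 2026-08-17) — Lean companion of `STRATEGY-CENSUS-r1.md`
# crux `CardyIKTransport.CornerLineDescent` (stmt-CriticalPhenomena-10964)

Kernel-checked parts of the census (everything sorry-free):

§1 POSITION (landed as `Theorems/CardyIKTransportCornerLineDescentSummitStrength.lean`, p165780, by this seat):
   `CardyFormulaZ2 → CornerLineDescent` (S → C) and `CardyIK → (CornerLineDescent ↔ CardyFormulaZ2)`; re-exported
   below as the census's verdict theorem `crux_summitStrength`.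
§2 DECOMPOSITION ATTEMPT D-R2 ("existence / identification" cut, the one typed split this seat found that is not
   by interpolation point and not in p1/s1): `CrudeLimitsExist` (every crude standard bond-ℤ² crossing probability
   converges to SOME limit) and `IdentifyGivenIK` (granted `CardyIK`, any such limit is Cardy's value).  Glue
   `cornerLineDescent_of_exist_of_identify` is two lines; BOTH pieces are consequences of the conjunct
   (`crudeLimitsExist_of_cardyFormulaZ2`, `identifyGivenIK_of_cardyFormulaZ2`), neither gives it alone (piece 1 has no
   values, piece 2 no existence) — so the split passes the C→S / S→C probes (c) and FAILS (d): piece 1 is the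
   uniqueness-of-subsequential-limits crux of routes CardyUniqueLimit / CardyAnchoredRigidity
   (`cardyFormulaZ2_iff_subseqCardy_and_subsingleton`), piece 2 is the IK ↔ bond universality statement with
   existence thrown in, which no comparison mechanism can use (census §3).  Recorded, NOT filed.
§3 The one-sided / duality cut and the split at `G_s` are s1's (S3/D3) and p1's (`SplitAtGs.lean`); not repeated.
-/

noncomputable section

namespace Summit.CriticalPhenomena.CardyFormulaZ2.Cruxes.CornerLineDescent.CensusR1

open Filter Topology
open Literature.Probability.RandomPlanarGeometry
open Summit.CriticalPhenomena.CardyFormulaZ2.Theses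
open Summit.CriticalPhenomena.CardyFormulaZ2.Theorems.CornerLineDescent
open Summit.CriticalPhenomena.CardyFormulaZ2.Theorems.CornerLineDescent.SymmetricSeed (bondStdCrossingProb)

/-! ## §1 Verdict theorem (re-export of the landed certificate) -/

/-- **Summit strength of the crux**: it is a corollary of the conjunct, and under the sibling crux `CardyIK`
(stmt-5913; delivered inside the route by r2 `IKLinearTransport`) it IS the conjunct. [folklore] -/
theorem crux_summitStrength :
    (_root_.CardyFormulaZ2 → CardyIKTransport.CornerLineDescent) ∧
    (CardyDiluteOrbit.CardyIK → (CardyIKTransport.CornerLineDescent ↔ _root_.CardyFormulaZ2)) ∧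
    (CardyIKTransport.IKLinearTransport → (CardyIKTransport.CornerLineDescent ↔ _root_.CardyFormulaZ2)) :=
  ⟨cornerLineDescent_of_cardyFormulaZ2, cornerLineDescent_iff_cardyFormulaZ2_of_cardyIK,
    cornerLineDescent_iff_cardyFormulaZ2_of_ikLinearTransport⟩

/-! ## §2 Decomposition attempt D-R2: existence / identification -/

/-- Piece 1 (would-be sub-crux): the crude standard bond-ℤ² crossing probability of EVERY conformal rectangle
converges as `δ → 0⁺` (to some limit; no value claimed). [folklore] -/
def CrudeLimitsExist : Prop :=
  ∀ R : ConformalRectangle, ∃ L : ℝ, Tendsto (bondStdCrossingProb R) (𝓝[>] 0) (𝓝 L)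

/-- Piece 2 (would-be sub-crux): granted Cardy for the IK gauge, any limit of a crude bond-ℤ² crossing
probability is Cardy's value of the modulus (identification, no existence claimed). [folklore] -/
def IdentifyGivenIK : Prop :=
  CardyDiluteOrbit.CardyIK → ∀ (R : ConformalRectangle) (L : ℝ),
    Tendsto (bondStdCrossingProb R) (𝓝[>] 0) (𝓝 L) →
      ∀ (φ : ConformalEquiv UpperHalfPlane.upperHalfPlaneSet R.carrier) (x : Fin 4 → ℝ),
        R.IsUniformizing φ x → L = cardyFunction (crossRatio x)

/-- GLUE (sorry-free): existence + identification ⇒ the crux. [folklore] -/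
theorem cornerLineDescent_of_exist_of_identify :
    CrudeLimitsExist → IdentifyGivenIK → CardyIKTransport.CornerLineDescent := by
  intro h₁ h₂ hIK R φ x hφx
  obtain ⟨L, hL⟩ := h₁ R
  have hval := h₂ hIK R L hL φ x hφx
  show Tendsto (bondStdCrossingProb R) (𝓝[>] 0) (𝓝 (cardyFunction (crossRatio x)))
  rw [← hval]
  exact hL

/-- S → piece 1: the conjunct gives existence (limits are Cardy's values; a uniformizing datum exists for every
conformal rectangle). [folklore] -/
theorem crudeLimitsExist_of_cardyFormulaZ2 : _root_.CardyFormulaZ2 → CrudeLimitsExist := by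
  intro hS R
  obtain ⟨φ, x, hφx⟩ := MarkedDomain.exists_isUniformizing_holds R
  exact ⟨_, crudeBondCardy_of_cardyFormulaZ2 hS R φ x hφx⟩

/-- S → piece 2: the conjunct identifies every limit (uniqueness of limits along the proper filter `𝓝[>] 0`).
[folklore] -/
theorem identifyGivenIK_of_cardyFormulaZ2 : _root_.CardyFormulaZ2 → IdentifyGivenIK := by
  intro hS _ R L hL φ x hφx
  exact tendsto_nhds_unique hL (crudeBondCardy_of_cardyFormulaZ2 hS R φ x hφx)

/-- Converse bookkeeping: under `CardyIK`, the crux gives both pieces back (so under `CardyIK` the split is an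
equivalence `crux ↔ piece 1 ∧ piece 2`, i.e. it relocates the conjunct, it does not cut it). [folklore] -/
theorem pieces_of_cornerLineDescent_of_cardyIK (hIK : CardyDiluteOrbit.CardyIK)
    (h : CardyIKTransport.CornerLineDescent) : CrudeLimitsExist ∧ IdentifyGivenIK :=
  have hS : _root_.CardyFormulaZ2 := (cornerLineDescent_iff_cardyFormulaZ2_of_cardyIK hIK).1 h
  ⟨crudeLimitsExist_of_cardyFormulaZ2 hS, identifyGivenIK_of_cardyFormulaZ2 hS⟩

end Summit.CriticalPhenomena.CardyFormulaZ2.Cruxes.CornerLineDescent.CensusR1
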